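/-
Copyright (c) 2026 the pub-hodgecm-mathlib formalisation cell (harness21).  Prover seat hodgecm-mathlib-K2E4-p23 (g2), Track B ∕ K2-LIT, h413 =
`stmt-HodgeConjecture-24833`, ENGINE E1, 5Res campaign, (113)∕hmc second half, part 2c = THE E1 CLOSER OF SHEET ROW 15(d) (dealer K2E1-plan (g7) (157) «=»):
ARCH-UNITARITY OF THE RESIDUAL POLES of the `χ`-Eisenstein family of `U(1,1)_{L∕L⁺}` at one complex place.
-/
import Summits.HodgeConjecture.HodgeConjecture.Theorems.K2E1ContinuedCircleAverageResidue          -- ★ p859872 (this seat) part 2b: `orbitIntegral_eq_of_eventuallyEq`, `orbitIntegral_residue_eq`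
import Summits.HodgeConjecture.HodgeConjecture.Theorems.K2E1ArchTorusCoefficientHolomorphicU11     -- ★ p859853 (this seat) part 2a: `differentiable_intervalIntegral_archTorusIntegrand_param`; brings ★ (113)(iii)
import Summits.HodgeConjecture.HodgeConjecture.Theorems.K2E1ArchTorusMatrixCoeffFromCircleAverage   -- ★ p859852 (this seat) part 1: `inner_rightRegular_eq_of_circleAverage`
import Summits.HodgeConjecture.HodgeConjecture.Theorems.K2E1ArchTorusCoefficientExpansionU11       -- ★ p859568 (this seat) F2b: `arch_unitarity_of_rightRegular_matrixCoeff`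
import Literature.NumberTheory.Automorphic.AutomorphicRepsGLCuspidalUnitary                        -- ★ `AdelicGroupData.quotFun`, `quotFun_toAutomorphicQuotient`
import Literature.NumberTheory.Automorphic.GLnCuspidalSpectrum                                     -- ★ `AdelicGroupData.smul_toAutomorphicQuotient`
import HarnessLib

/-!
# K2·E1 — `K2E1ArchUnitarityOfResidualPolesU11`: A POLE `z₀` OF THE CONTINUED `χ`-EISENSTEIN FAMILY WITH A NONZERO SQUARE-INTEGRABLE RESIDUE HAS
# `z₀ + i t_w ∈ ℝ ∪ (½ + iℝ)` — THE ARCHIMEDEAN UNITARITY CONSTRAINT (SHEET row 15(d), closer of the (113)∕hmc chain)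

Track B ∕ K2-LIT, crux h413 = `stmt-HodgeConjecture-24833`, route of record `HCCMUnconditional`; cell `hodgecm-mathlib`, squad K2, ENGINE E1 (5Res campaign, ARCH-UNITARITY leg,
SHEET `K2/K2-defs1/g6/SHEET-5Res-b-chi-twins.K2-defs1-g6.md` row 15(d)).  Prover seat `hodgecm-mathlib-K2E4-p23` (g2).  THEOREMS ONLY (no `def`, no `instance`, no notation, no
named-fact hypothesis, no `sorry`); lane `--supports stmt-HodgeConjecture-24833 --as helper` (count-neutral).  CLOSES NO SOCKET.

THE CHAIN ASSEMBLED HERE (all ★, this seat): (113)(iii) `circleAverage_torusAt_eisensteinSeriesU_eq` (Godement domain) → part 2b `orbitIntegral_eq_of_eventuallyEq` (identity theorem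
on the domain `D` of the continued family; symbol entire by part 2a) → part 2b `orbitIntegral_residue_eq` (the residue `ψ = Res_{z₀}` inherits the circle-average identity) → the
dictionary `Ψ = quotFun ψ` on `X = G(𝔸)∕G(F)` → part 1 `inner_rightRegular_eq_of_circleAverage` (`hmc`) → F2b `arch_unitarity_of_rightRegular_matrixCoeff`.

LETTERS (all visible, hypothesis-first; payers named):
* section letters for `f_z := flatSectionU φ z` at the complex place `w`, for every `z` (resp. `1 < Re z`): (G) `hBglob`, (K) `hK` (`K_w`-type `(p,q)`), (B) `hB` (`χ_w|_{ℝ₊}·height`, exponent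
  `z + i t`), Godement summability `hsum` — payer: the (χ,τ) campaign (★ `flatSectionU_borel_mul_of_isChiSection`, ★ `summable_eisensteinSeriesU_flatSectionU_cm_two`);
* continuation letters (E1) `hEd`, (E4) `hEc`, (E2-bd) `hEbd` on an open preconnected `D` with a Godement point `z₁ ∈ D`, `1 < Re z₁`, and the agreement `hagree : Ec z = E(f_z)` on
  `D ∩ {1 < Re}` — payer: row 13 ★ `K2E1ChiEisensteinMeromorphicU2` + the (χ,τ)-EXPORTS;
* pole letters at `z₀`: punctured ball `B(z₀,ρ)∖{z₀} ⊆ D`, `Fp g` analytic at `z₀` agreeing with `(z − z₀)Ẽ(z)(g)` on `𝓝[≠] z₀` (★ N = 3 (F) shape), residue `ψ g := Fp g z₀`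
  left-`quotientSubgroup`-invariant (`hψΓ`), its descent `Ψ = quotFun ψ` measurable, in `L²(μ)` and nonzero — payer: MS pole control ∕ residual spectrum files.
HEADS: §1 `eisensteinSeriesU_mul_circleAt` (K-type passes to `E(f)`), `continued_mul_circleAt` (and to `Ẽ(z)` on `D`), `residue_mul_circleAt` (and to the residue); §2
**`circleAverage_residue_eq`** `∫₀^{2π} e^{−iqθ} ψ(g·k_w(θ)·t_w(a)) dθ = (∫₀^{2π} archTorusIntegrand (z₀ + it) (p−q) a) · ψ(g)`; §3 `quotFun_residue_kType`, `quotFun_residue_circleAverage` (the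
letters (KΨ), (AV) of part 1 for `Ψ = quotFun ψ`), **`inner_rightRegular_torusAt_residue`** (`hmc`), **`arch_unitarity_of_residual_pole : (z₀ + t·I).im = 0 ∨ (z₀ + t·I).re = 1∕2`**.
HONEST LABEL: HC_CM is proved only modulo the 7 printed citations (2 remaining named inputs: hLiu418 = `stmt-HodgeConjecture-24832`, h413 = `stmt-HodgeConjecture-24833`) until rung 0
closes; this file asserts no named fact, is conditional by construction on the visible letters above, and closes no socket; count-neutral.

## References
* [MoeglinWaldspurger1995] C. Mœglin, J.-L. Waldspurger, *Spectral decomposition and Eisenstein series* (1995), IV.1.11, IV.3, V.3.13.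
* [Knapp1986] A. W. Knapp, *Representation Theory of Semisimple Groups* (1986), VII §1, XVI §1 (unitarity of `I(χ_w, s)` forces `s ∈ ℝ ∪ (½ + iℝ)`).
* [Langlands1976] R. P. Langlands, LNM 544 (1976), §7 (square-integrable residues).
-/

set_option autoImplicit false
-- the mandated namespace repeats the single-problem summit's segment (`HodgeConjecture.HodgeConjecture`)
set_option linter.dupNamespace false

noncomputable section

open NumberField NumberField.InfinitePlace Matrix MeasureTheory intervalIntegral Metric Set Filter
open scoped MatrixGroups ComplexConjugate Real Topology InnerProductSpace
open Literature.NumberTheory.Automorphic Literature.NumberTheory.Automorphic.UnitaryGroup AdelicGroupData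
open Summit.HodgeConjecture.HodgeConjecture.Cruxes.H413.K2E1ArchTorusFamilyU11Defs
open Summit.HodgeConjecture.HodgeConjecture.Cruxes.H413.K2E1ArchTorusCoefficientU11Defs
open Summit.HodgeConjecture.HodgeConjecture.Cruxes.H413.K2E1ArchTorusActionEisensteinU11
open Summit.HodgeConjecture.HodgeConjecture.Cruxes.H413.K2E1ArchTorusCoefficientHolomorphicU11
open Summit.HodgeConjecture.HodgeConjecture.Cruxes.H413.K2E1ArchTorusMatrixCoeffFromCircleAverage
open Summit.HodgeConjecture.HodgeConjecture.Cruxes.H413.K2E1ArchTorusCoefficientExpansionU11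
open Summit.HodgeConjecture.HodgeConjecture.Cruxes.H413.K2E1ContinuedCircleAverageResidue
open Summit.HodgeConjecture.HodgeConjecture.Cruxes.H413.K2E1BorelEisensteinU

namespace Summit.HodgeConjecture.HodgeConjecture.Cruxes.H413.K2E1ArchUnitarityOfResidualPolesU11

variable (L : Type) [Field L] [NumberField L] [IsCMField L] (w : {w : InfinitePlace L // IsComplex w})

/-! ## §1 The `K_w`-type passes to `E(f)`, to the continued family, and to the residue -/

/-- The right `K_w`-type of a section passes to its Eisenstein series, with NO convergence hypothesis (`tsum` is homogeneous). [cite: MoeglinWaldspurger1995, II.1.5] -/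
theorem eisensteinSeriesU_mul_circleAt (f : (quasiSplit (↥(maximalRealSubfield L)) L (IsCMField.complexConj L) 2).Adelic → ℂ) (p q : ℤ)
    (hK : ∀ x (u v : Circle), f (x * circleAt L w u v) = (u : ℂ) ^ p * (v : ℂ) ^ q * f x)
    (y : (quasiSplit (↥(maximalRealSubfield L)) L (IsCMField.complexConj L) 2).Adelic) (u v : Circle) :
    eisensteinSeriesU f (y * circleAt L w u v) = (u : ℂ) ^ p * (v : ℂ) ^ q * eisensteinSeriesU f y := by
  rw [eisensteinSeriesU_def, eisensteinSeriesU_def, ← tsum_mul_left]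
  exact tsum_congr fun qq => by rw [← mul_assoc, hK]

/-- The `K_w`-type passes to the continued family on all of `D` (identity theorem from the Godement germ). [cite: MoeglinWaldspurger1995, IV.1.9] -/
theorem continued_mul_circleAt (φ : (quasiSplit (↥(maximalRealSubfield L)) L (IsCMField.complexConj L) 2).Adelic → ℂ) (p q : ℤ)
    (hK : ∀ (z : ℂ) x (u v : Circle), flatSectionU φ z (x * circleAt L w u v) = (u : ℂ) ^ p * (v : ℂ) ^ q * flatSectionU φ z x)
    (Ec : ℂ → (quasiSplit (↥(maximalRealSubfield L)) L (IsCMField.complexConj L) 2).Adelic → ℂ) {D : Set ℂ} (hDo : IsOpen D) (hDc : IsPreconnected D)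
    (hEd : ∀ y, DifferentiableOn ℂ (fun z => Ec z y) D)
    (hagree : ∀ z ∈ D, 1 < z.re → Ec z = eisensteinSeriesU (flatSectionU φ z)) {z₁ : ℂ} (hz₁ : z₁ ∈ D) (hz₁re : 1 < z₁.re)
    {z : ℂ} (hz : z ∈ D) (y : (quasiSplit (↥(maximalRealSubfield L)) L (IsCMField.complexConj L) 2).Adelic) (u v : Circle) :
    Ec z (y * circleAt L w u v) = (u : ℂ) ^ p * (v : ℂ) ^ q * Ec z y := by
  have hL : AnalyticOnNhd ℂ (fun z => Ec z (y * circleAt L w u v)) D := (Complex.analyticOnNhd_iff_differentiableOn hDo).2 (hEd _)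
  have hR : AnalyticOnNhd ℂ (fun z => (u : ℂ) ^ p * (v : ℂ) ^ q * Ec z y) D :=
    (Complex.analyticOnNhd_iff_differentiableOn hDo).2 ((differentiableOn_const _).mul (hEd y))
  have hgerm : (fun z => Ec z (y * circleAt L w u v)) =ᶠ[𝓝 z₁] fun z => (u : ℂ) ^ p * (v : ℂ) ^ q * Ec z y := by
    filter_upwards [(hDo.inter (isOpen_lt continuous_const Complex.continuous_re)).mem_nhds ⟨hz₁, hz₁re⟩] with s hs
    rw [hagree s hs.1 hs.2, eisensteinSeriesU_mul_circleAt L w _ p q (hK s)]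
  exact hL.eqOn_of_preconnected_of_eventuallyEq hR hDc hz₁ hgerm hz

/-- The `K_w`-type passes to the residue `ψ(y) = Fp y z₀` (limits along `𝓝[≠] z₀` are unique). [cite: MoeglinWaldspurger1995, IV.1.11] -/
theorem residue_mul_circleAt (φ : (quasiSplit (↥(maximalRealSubfield L)) L (IsCMField.complexConj L) 2).Adelic → ℂ) (p q : ℤ)
    (hK : ∀ (z : ℂ) x (u v : Circle), flatSectionU φ z (x * circleAt L w u v) = (u : ℂ) ^ p * (v : ℂ) ^ q * flatSectionU φ z x)
    (Ec : ℂ → (quasiSplit (↥(maximalRealSubfield L)) L (IsCMField.complexConj L) 2).Adelic → ℂ) {D : Set ℂ} (hDo : IsOpen D) (hDc : IsPreconnected D)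
    (hEd : ∀ y, DifferentiableOn ℂ (fun z => Ec z y) D)
    (hagree : ∀ z ∈ D, 1 < z.re → Ec z = eisensteinSeriesU (flatSectionU φ z)) {z₁ : ℂ} (hz₁ : z₁ ∈ D) (hz₁re : 1 < z₁.re)
    (z₀ : ℂ) {ρ : ℝ} (hρ : 0 < ρ) (hρD : ∀ z : ℂ, z ≠ z₀ → dist z z₀ < ρ → z ∈ D)
    (Fp : (quasiSplit (↥(maximalRealSubfield L)) L (IsCMField.complexConj L) 2).Adelic → ℂ → ℂ) (hF : ∀ y, AnalyticAt ℂ (Fp y) z₀)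
    (hFE : ∀ y, Fp y =ᶠ[𝓝[≠] z₀] fun z => (z - z₀) * Ec z y)
    (y : (quasiSplit (↥(maximalRealSubfield L)) L (IsCMField.complexConj L) 2).Adelic) (u v : Circle) :
    Fp (y * circleAt L w u v) z₀ = (u : ℂ) ^ p * (v : ℂ) ^ q * Fp y z₀ := by
  have hpt : ∀ y', Tendsto (fun z => (z - z₀) * Ec z y') (𝓝[≠] z₀) (𝓝 (Fp y' z₀)) := fun y' =>
    ((hF y').continuousAt.tendsto.mono_left nhdsWithin_le_nhds).congr' (hFE y')
  have hmem : {z : ℂ | z ≠ z₀} ∩ ball z₀ ρ ∈ 𝓝[≠] z₀ := inter_mem_nhdsWithin _ (ball_mem_nhds _ hρ)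
  have heq : (fun z => (z - z₀) * Ec z (y * circleAt L w u v)) =ᶠ[𝓝[≠] z₀] fun z => (u : ℂ) ^ p * (v : ℂ) ^ q * ((z - z₀) * Ec z y) := by
    filter_upwards [hmem] with z hz
    rw [continued_mul_circleAt L w φ p q hK Ec hDo hDc hEd hagree hz₁ hz₁re (hρD z hz.1 (mem_ball.1 hz.2))]
    ring
  exact tendsto_nhds_unique ((hpt _).congr' heq) ((hpt y).const_mul _)

/-! ## §2 The residue inherits the circle-average identity -/

/-- **THE RESIDUE INHERITS THE CIRCLE AVERAGE**: `∫₀^{2π} e^{−iqθ}·ψ(g·k_w(θ)·t_w(a)) dθ = (∫₀^{2π} archTorusIntegrand (z₀ + it) (p − q) a θ dθ)·ψ(g)`, `ψ(y) = Fp y z₀`, for `a > 0` —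
★ (113)(iii) on the Godement germ at `z₁`, continued over `D` (★ part 2b §3, symbol entire by ★ part 2a), then passed to the residue (★ part 2b §4).
[cite: MoeglinWaldspurger1995, IV.1.11] [cite: Knapp1986, VII §1] -/
theorem circleAverage_residue_eq (φ : (quasiSplit (↥(maximalRealSubfield L)) L (IsCMField.complexConj L) 2).Adelic → ℂ) (t : ℝ) (p q : ℤ)
    (hBglob : ∀ z : ℂ, 1 < z.re → ∀ b ∈ borelAdelic (↥(maximalRealSubfield L)) L (IsCMField.complexConj L) 2, ∃ c : ℂ, ∀ x,
      flatSectionU φ z (b * x) = c * flatSectionU φ z x)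
    (hK : ∀ (z : ℂ) x (u v : Circle), flatSectionU φ z (x * circleAt L w u v) = (u : ℂ) ^ p * (v : ℂ) ^ q * flatSectionU φ z x)
    (hB : ∀ (z : ℂ) (b : archLocal L 2 ((StdForm.antidiagonal 2).over L) w) (r : ℝ), 0 < r →
      (((b : GL (Fin 2) ℂ) : Matrix (Fin 2) (Fin 2) ℂ) 1 0 = 0) → (((b : GL (Fin 2) ℂ) : Matrix (Fin 2) (Fin 2) ℂ) 0 0 = (r : ℂ)) →
      ∀ x, flatSectionU φ z (adelicSingle (↥(maximalRealSubfield L)) L (IsCMField.complexConj L) 2 ((StdForm.antidiagonal 2).over L) (IsCMField.complexConj_ne_one L)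
        (complexConj_smul_infinitePlace L) w b * x) = ((r ^ 2 : ℝ) : ℂ) ^ (z + t * Complex.I) * flatSectionU φ z x)
    (hsum : ∀ z : ℂ, 1 < z.re → ∀ g, Summable fun qq : Quotient (MulAction.orbitRel
        ↥(borelU ((IsCMField.complexConj L : L ≃ₐ[↥(maximalRealSubfield L)] L) : L →+* L) ((StdForm.antidiagonal 2).over L))
        ↥(unitaryGroupOfForm ((IsCMField.complexConj L : L ≃ₐ[↥(maximalRealSubfield L)] L) : L →+* L) ((StdForm.antidiagonal 2).over L))) =>
      ‖flatSectionU φ z ((quasiSplit (↥(maximalRealSubfield L)) L (IsCMField.complexConj L) 2).toAdelic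
          (Quotient.out qq : ↥(unitaryGroupOfForm ((IsCMField.complexConj L : L ≃ₐ[↥(maximalRealSubfield L)] L) : L →+* L) ((StdForm.antidiagonal 2).over L))) * g)‖)
    (Ec : ℂ → (quasiSplit (↥(maximalRealSubfield L)) L (IsCMField.complexConj L) 2).Adelic → ℂ) {D : Set ℂ} (hDo : IsOpen D) (hDc : IsPreconnected D)
    (hEd : ∀ y, DifferentiableOn ℂ (fun z => Ec z y) D) (hEc : ∀ z ∈ D, Continuous (Ec z))
    (hEbd : ∀ z₁ ∈ D, ∀ K : Set (quasiSplit (↥(maximalRealSubfield L)) L (IsCMField.complexConj L) 2).Adelic, IsCompact K →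
      ∃ V ∈ 𝓝 z₁, ∃ M : ℝ, ∀ z ∈ V, ∀ y ∈ K, ‖Ec z y‖ ≤ M)
    (hagree : ∀ z ∈ D, 1 < z.re → Ec z = eisensteinSeriesU (flatSectionU φ z)) {z₁ : ℂ} (hz₁ : z₁ ∈ D) (hz₁re : 1 < z₁.re)
    (z₀ : ℂ) {ρ : ℝ} (hρ : 0 < ρ) (hρD : ∀ z : ℂ, z ≠ z₀ → dist z z₀ < ρ → z ∈ D)
    (Fp : (quasiSplit (↥(maximalRealSubfield L)) L (IsCMField.complexConj L) 2).Adelic → ℂ → ℂ) (hF : ∀ y, AnalyticAt ℂ (Fp y) z₀)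
    (hFE : ∀ y, Fp y =ᶠ[𝓝[≠] z₀] fun z => (z - z₀) * Ec z y)
    {a : ℝ} (ha : 0 < a) (g : (quasiSplit (↥(maximalRealSubfield L)) L (IsCMField.complexConj L) 2).Adelic) :
    (∫ θ in (0 : ℝ)..2 * π, Complex.exp (-((q : ℂ) * θ * Complex.I)) * Fp (g * circleAt L w 1 (Circle.exp θ) * torusAt L w a) z₀) =
      (∫ θ in (0 : ℝ)..2 * π, archTorusIntegrand (z₀ + t * Complex.I) (p - q) a θ) * Fp g z₀ := by
  -- the orbit, the weight, the symbol
  have horb : Continuous fun θ : ℝ => g * circleAt L w 1 (Circle.exp θ) * torusAt L w a :=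
    (continuous_const.mul (continuous_circleAt_exp L w)).mul continuous_const
  have hw : Continuous fun θ : ℝ => Complex.exp (-((q : ℂ) * θ * Complex.I)) :=
    Complex.continuous_exp.comp ((continuous_const.mul Complex.continuous_ofReal).mul continuous_const).neg
  have hCd : Differentiable ℂ fun z : ℂ => ∫ θ in (0 : ℝ)..2 * π, archTorusIntegrand (z + t * Complex.I) (p - q) a θ :=
    (differentiable_intervalIntegral_archTorusIntegrand_param (p - q) ha).comp (differentiable_id.add (differentiable_const _))
  -- the identity on all of `D`
  have hid : ∀ z ∈ D, (∫ θ in (0 : ℝ)..2 * π, Complex.exp (-((q : ℂ) * θ * Complex.I)) * Ec z (g * circleAt L w 1 (Circle.exp θ) * torusAt L w a)) =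
      (∫ θ in (0 : ℝ)..2 * π, archTorusIntegrand (z + t * Complex.I) (p - q) a θ) * Ec z g := fun z hz => by
    refine orbitIntegral_eq_of_eventuallyEq Ec hDo hDc hEd hEc hEbd horb hw g hCd.differentiableOn hz₁ ?_ hz
    filter_upwards [(hDo.inter (isOpen_lt continuous_const Complex.continuous_re)).mem_nhds ⟨hz₁, hz₁re⟩] with s hs
    rw [hagree s hs.1 hs.2]
    exact circleAverage_torusAt_eisensteinSeriesU_eq L w (flatSectionU φ s) (s + t * Complex.I) p q (hBglob s hs.2) (hK s) (hB s) ha g (hsum s hs.2 g)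
  -- pass to the residue
  exact orbitIntegral_residue_eq Ec hDo z₀ hρ hρD hEd hEc hEbd Fp hF hFE horb hw g hCd.continuous.continuousWithinAt hid

/-! ## §3 The dictionary to `X = G(𝔸)∕G(F)` and the arch-unitarity constraint -/

/-- **(KΨ) FOR THE DESCENDED RESIDUE**: with `Ψ = quotFun ψ` (`Ψ[g] = ψ(g⁻¹)`), `ψ` left-invariant under the quotient subgroup and of right `K_w`-type `(p,q)`:
`Ψ(k_w(θ)⁻¹ • x) = e^{iqθ}·Ψ(x)`. [cite: MoeglinWaldspurger1995, IV.3] -/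
theorem quotFun_residue_kType {ψ : (quasiSplit (↥(maximalRealSubfield L)) L (IsCMField.complexConj L) 2).Adelic → ℂ} (p q : ℤ)
    (hψΓ : ∀ γ ∈ (quasiSplit (↥(maximalRealSubfield L)) L (IsCMField.complexConj L) 2).quotientSubgroup, ∀ g, ψ (γ * g) = ψ g)
    (hψK : ∀ y (u v : Circle), ψ (y * circleAt L w u v) = (u : ℂ) ^ p * (v : ℂ) ^ q * ψ y)
    (x : (quasiSplit (↥(maximalRealSubfield L)) L (IsCMField.complexConj L) 2).automorphicQuotient) (θ : ℝ) :
    (quasiSplit (↥(maximalRealSubfield L)) L (IsCMField.complexConj L) 2).quotFun ψ ((circleAt L w 1 (Circle.exp θ))⁻¹ • x) =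
      Complex.exp ((q : ℂ) * θ * Complex.I) * (quasiSplit (↥(maximalRealSubfield L)) L (IsCMField.complexConj L) 2).quotFun ψ x := by
  obtain ⟨g, hg⟩ := QuotientGroup.mk_surjective x
  have hx : x = (quasiSplit (↥(maximalRealSubfield L)) L (IsCMField.complexConj L) 2).toAutomorphicQuotient g := hg.symm
  rw [hx, AdelicGroupData.smul_toAutomorphicQuotient, AdelicGroupData.quotFun_toAutomorphicQuotient hψΓ, AdelicGroupData.quotFun_toAutomorphicQuotient hψΓ,
    _root_.mul_inv_rev, inv_inv, hψK, Circle.coe_one, _root_.one_zpow, one_mul, Circle.coe_exp, ← Complex.exp_int_mul]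
  ring_nf

/-- **(AV) FOR THE DESCENDED RESIDUE**: `(2π)⁻¹ ∫₀^{2π} e^{−iqθ}·Ψ((t_w(a)·k_w(θ)⁻¹) • x) dθ = archTorusCoeff (z₀ + it) (p − q) a · Ψ(x)` — the classical identity of §2 at `a⁻¹` read through
`Ψ[g] = ψ(g⁻¹)` (★ `torusAt_inv`, ★ `archTorusCoeff_inv`). [cite: MoeglinWaldspurger1995, IV.3] [cite: Knapp1986, VII §1] -/
theorem quotFun_residue_circleAverage {ψ : (quasiSplit (↥(maximalRealSubfield L)) L (IsCMField.complexConj L) 2).Adelic → ℂ} (s : ℂ) (p q : ℤ)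
    (hψΓ : ∀ γ ∈ (quasiSplit (↥(maximalRealSubfield L)) L (IsCMField.complexConj L) 2).quotientSubgroup, ∀ g, ψ (γ * g) = ψ g)
    (hψav : ∀ {a : ℝ}, 0 < a → ∀ g, (∫ θ in (0 : ℝ)..2 * π, Complex.exp (-((q : ℂ) * θ * Complex.I)) * ψ (g * circleAt L w 1 (Circle.exp θ) * torusAt L w a)) =
      (∫ θ in (0 : ℝ)..2 * π, archTorusIntegrand s (p - q) a θ) * ψ g)
    {a : ℝ} (ha : 0 < a) (x : (quasiSplit (↥(maximalRealSubfield L)) L (IsCMField.complexConj L) 2).automorphicQuotient) :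
    ((2 * π)⁻¹ : ℝ) • ∫ θ in (0 : ℝ)..2 * π, Complex.exp (-((q : ℂ) * θ * Complex.I)) *
        (quasiSplit (↥(maximalRealSubfield L)) L (IsCMField.complexConj L) 2).quotFun ψ ((torusAt L w a * (circleAt L w 1 (Circle.exp θ))⁻¹) • x) =
      archTorusCoeff s (p - q) a * (quasiSplit (↥(maximalRealSubfield L)) L (IsCMField.complexConj L) 2).quotFun ψ x := by
  obtain ⟨g, hg⟩ := QuotientGroup.mk_surjective x
  have hx : x = (quasiSplit (↥(maximalRealSubfield L)) L (IsCMField.complexConj L) 2).toAutomorphicQuotient g := hg.symm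
  have hpt : ∀ θ : ℝ, (quasiSplit (↥(maximalRealSubfield L)) L (IsCMField.complexConj L) 2).quotFun ψ
      ((torusAt L w a * (circleAt L w 1 (Circle.exp θ))⁻¹) • (quasiSplit (↥(maximalRealSubfield L)) L (IsCMField.complexConj L) 2).toAutomorphicQuotient g) =
      ψ (g⁻¹ * circleAt L w 1 (Circle.exp θ) * torusAt L w a⁻¹) := fun θ => by
    rw [AdelicGroupData.smul_toAutomorphicQuotient, AdelicGroupData.quotFun_toAutomorphicQuotient hψΓ, _root_.mul_inv_rev, _root_.mul_inv_rev, inv_inv, torusAt_inv, mul_assoc]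
  rw [hx, AdelicGroupData.quotFun_toAutomorphicQuotient hψΓ g]
  simp_rw [hpt]
  rw [hψav (inv_pos.2 ha) g⁻¹, ← archTorusCoeff_inv s (p - q) a, archTorusCoeff_def, Complex.real_smul, Complex.real_smul]
  ring

variable (μ : Measure (quasiSplit (↥(maximalRealSubfield L)) L (IsCMField.complexConj L) 2).automorphicQuotient)
  [SMulInvariantMeasure (quasiSplit (↥(maximalRealSubfield L)) L (IsCMField.complexConj L) 2).Adelic
    (quasiSplit (↥(maximalRealSubfield L)) L (IsCMField.complexConj L) 2).automorphicQuotient μ] [IsFiniteMeasure μ]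

/-- **`hmc` FOR THE DESCENDED RESIDUE**: `⟪R(t_w(a))Ψ, Ψ⟫ = archTorusCoeff (z₀ + it) (p − q) a · ‖Ψ‖²` for `a > 0` (★ part 1 `inner_rightRegular_eq_of_circleAverage` on (KΨ) + (AV)).
[cite: MoeglinWaldspurger1995, IV.3] [cite: Knapp1986, VII §1] -/
theorem inner_rightRegular_torusAt_residue {ψ : (quasiSplit (↥(maximalRealSubfield L)) L (IsCMField.complexConj L) 2).Adelic → ℂ} (s : ℂ) (p q : ℤ)
    (hψΓ : ∀ γ ∈ (quasiSplit (↥(maximalRealSubfield L)) L (IsCMField.complexConj L) 2).quotientSubgroup, ∀ g, ψ (γ * g) = ψ g)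
    (hψK : ∀ y (u v : Circle), ψ (y * circleAt L w u v) = (u : ℂ) ^ p * (v : ℂ) ^ q * ψ y)
    (hψav : ∀ {a : ℝ}, 0 < a → ∀ g, (∫ θ in (0 : ℝ)..2 * π, Complex.exp (-((q : ℂ) * θ * Complex.I)) * ψ (g * circleAt L w 1 (Circle.exp θ) * torusAt L w a)) =
      (∫ θ in (0 : ℝ)..2 * π, archTorusIntegrand s (p - q) a θ) * ψ g)
    (hΨm : Measurable ((quasiSplit (↥(maximalRealSubfield L)) L (IsCMField.complexConj L) 2).quotFun ψ))
    (hΨ2 : MemLp ((quasiSplit (↥(maximalRealSubfield L)) L (IsCMField.complexConj L) 2).quotFun ψ) 2 μ) {a : ℝ} (ha : 0 < a) :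
    ⟪(quasiSplit (↥(maximalRealSubfield L)) L (IsCMField.complexConj L) 2).rightRegular μ (torusAt L w a) (hΨ2.toLp _), hΨ2.toLp _⟫_ℂ =
      archTorusCoeff s (p - q) a * (((‖hΨ2.toLp _‖ ^ 2 : ℝ)) : ℂ) :=
  inner_rightRegular_eq_of_circleAverage _ μ hΨm hΨ2 q (torusAt L w a) (archTorusCoeff s (p - q) a) (continuous_circleAt_exp L w)
    (quotFun_residue_kType L w p q hψΓ hψK) (quotFun_residue_circleAverage L w s p q hψΓ hψav ha)

/-- **ARCH-UNITARITY OF A RESIDUAL POLE** (SHEET row 15(d)).  If the residue `ψ = Res_{z₀} Ẽ` of the continued `χ`-Eisenstein family — with the section letters (G)(K)(B)+Godement at the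
complex place `w` (`K_w`-type `(p,q)`, `χ_w|_{ℝ₊} ↔ t`), the continuation letters (E1)(E4)(E2-bd) on a preconnected `D` through a Godement point, and the simple-pole letter at `z₀` —
is left-invariant under the quotient subgroup and descends to a NONZERO element of `L²(X, μ)` (`μ` invariant, finite), then **`(z₀ + it).im = 0 ∨ (z₀ + it).re = 1∕2`**: the
archimedean parameter `s = z₀ + it_w` of the residual representation is real (complementary series) or on the unitary axis.  (§2 ∘ §1 ∘ ★ part 1 ∘ ★ F2b.)
[cite: Knapp1986, XVI §1] [cite: MoeglinWaldspurger1995, IV.3, V.3.13] -/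
theorem arch_unitarity_of_residual_pole (φ : (quasiSplit (↥(maximalRealSubfield L)) L (IsCMField.complexConj L) 2).Adelic → ℂ) (t : ℝ) (p q : ℤ)
    (hBglob : ∀ z : ℂ, 1 < z.re → ∀ b ∈ borelAdelic (↥(maximalRealSubfield L)) L (IsCMField.complexConj L) 2, ∃ c : ℂ, ∀ x,
      flatSectionU φ z (b * x) = c * flatSectionU φ z x)
    (hK : ∀ (z : ℂ) x (u v : Circle), flatSectionU φ z (x * circleAt L w u v) = (u : ℂ) ^ p * (v : ℂ) ^ q * flatSectionU φ z x)
    (hB : ∀ (z : ℂ) (b : archLocal L 2 ((StdForm.antidiagonal 2).over L) w) (r : ℝ), 0 < r →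
      (((b : GL (Fin 2) ℂ) : Matrix (Fin 2) (Fin 2) ℂ) 1 0 = 0) → (((b : GL (Fin 2) ℂ) : Matrix (Fin 2) (Fin 2) ℂ) 0 0 = (r : ℂ)) →
      ∀ x, flatSectionU φ z (adelicSingle (↥(maximalRealSubfield L)) L (IsCMField.complexConj L) 2 ((StdForm.antidiagonal 2).over L) (IsCMField.complexConj_ne_one L)
        (complexConj_smul_infinitePlace L) w b * x) = ((r ^ 2 : ℝ) : ℂ) ^ (z + t * Complex.I) * flatSectionU φ z x)
    (hsum : ∀ z : ℂ, 1 < z.re → ∀ g, Summable fun qq : Quotient (MulAction.orbitRel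
        ↥(borelU ((IsCMField.complexConj L : L ≃ₐ[↥(maximalRealSubfield L)] L) : L →+* L) ((StdForm.antidiagonal 2).over L))
        ↥(unitaryGroupOfForm ((IsCMField.complexConj L : L ≃ₐ[↥(maximalRealSubfield L)] L) : L →+* L) ((StdForm.antidiagonal 2).over L))) =>
      ‖flatSectionU φ z ((quasiSplit (↥(maximalRealSubfield L)) L (IsCMField.complexConj L) 2).toAdelic
          (Quotient.out qq : ↥(unitaryGroupOfForm ((IsCMField.complexConj L : L ≃ₐ[↥(maximalRealSubfield L)] L) : L →+* L) ((StdForm.antidiagonal 2).over L))) * g)‖)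
    (Ec : ℂ → (quasiSplit (↥(maximalRealSubfield L)) L (IsCMField.complexConj L) 2).Adelic → ℂ) {D : Set ℂ} (hDo : IsOpen D) (hDc : IsPreconnected D)
    (hEd : ∀ y, DifferentiableOn ℂ (fun z => Ec z y) D) (hEc : ∀ z ∈ D, Continuous (Ec z))
    (hEbd : ∀ z₁ ∈ D, ∀ K : Set (quasiSplit (↥(maximalRealSubfield L)) L (IsCMField.complexConj L) 2).Adelic, IsCompact K →
      ∃ V ∈ 𝓝 z₁, ∃ M : ℝ, ∀ z ∈ V, ∀ y ∈ K, ‖Ec z y‖ ≤ M)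
    (hagree : ∀ z ∈ D, 1 < z.re → Ec z = eisensteinSeriesU (flatSectionU φ z)) {z₁ : ℂ} (hz₁ : z₁ ∈ D) (hz₁re : 1 < z₁.re)
    (z₀ : ℂ) {ρ : ℝ} (hρ : 0 < ρ) (hρD : ∀ z : ℂ, z ≠ z₀ → dist z z₀ < ρ → z ∈ D)
    (Fp : (quasiSplit (↥(maximalRealSubfield L)) L (IsCMField.complexConj L) 2).Adelic → ℂ → ℂ) (hF : ∀ y, AnalyticAt ℂ (Fp y) z₀)
    (hFE : ∀ y, Fp y =ᶠ[𝓝[≠] z₀] fun z => (z - z₀) * Ec z y)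
    (hψΓ : ∀ γ ∈ (quasiSplit (↥(maximalRealSubfield L)) L (IsCMField.complexConj L) 2).quotientSubgroup, ∀ g, Fp (γ * g) z₀ = Fp g z₀)
    (hΨm : Measurable ((quasiSplit (↥(maximalRealSubfield L)) L (IsCMField.complexConj L) 2).quotFun fun g => Fp g z₀))
    (hΨ2 : MemLp ((quasiSplit (↥(maximalRealSubfield L)) L (IsCMField.complexConj L) 2).quotFun fun g => Fp g z₀) 2 μ) (hne : hΨ2.toLp _ ≠ 0) :
    (z₀ + t * Complex.I).im = 0 ∨ (z₀ + t * Complex.I).re = 1 / 2 :=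
  arch_unitarity_of_rightRegular_matrixCoeff (quasiSplit (↥(maximalRealSubfield L)) L (IsCMField.complexConj L) 2) μ (torusAt L w)
    (fun a _ => torusAt_inv L w a) hne fun _ ha =>
      inner_rightRegular_torusAt_residue L w μ (z₀ + t * Complex.I) p q hψΓ
        (residue_mul_circleAt L w φ p q hK Ec hDo hDc hEd hagree hz₁ hz₁re z₀ hρ hρD Fp hF hFE)
        (fun ha' g => circleAverage_residue_eq L w φ t p q hBglob hK hB hsum Ec hDo hDc hEd hEc hEbd hagree hz₁ hz₁re z₀ hρ hρD Fp hF hFE ha' g)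
        hΨm hΨ2 ha

end Summit.HodgeConjecture.HodgeConjecture.Cruxes.H413.K2E1ArchUnitarityOfResidualPolesU11

end
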